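import Summits.Ventures.CertifiedArithmetic.LowPrec.GemmFirstRegimeSpineZ
import HarnessLib

/-!
# GEMM worst case LXIX-a — THE WINDOW past the first regime, part 1: base arithmetic with the
# multiplier `k = d + 1`, one level-0 step of integer RNE, and the phase-0 potential step

HONEST FRAMING: certified error envelopes and provably optimal rounding/accumulation schemes for
low-precision formats under stated cost models; every table by two implementations; no hardware or
vendor claims.

Files LXIV-a/b/c proved the exact first-regime law `R(x, n₀ + k) ≤ max(k/(B+k), (k-1)/(T+k-1))`
for `k ≤ T/2 = 2^(p-1)` by the SPINE bookkeeping `T·E_n ≤ d·X⁻_n` (`d = k - 1`) of the signed error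
`E_j = ŝ_j - s_j` against the slack `X⁻_j = L_j - E_j` (grid units, `T = 2^(m+1)`, `m = manBits`).
Files LXIX-a/b/c push the SAME inequality with the larger multiplier `k = d + 1` through the
WINDOW `T/2 < k ≤ T/2 + 4` just past the first regime, where the certified tables show the law's
second branch `k/(T+k)` still optimal for four more steps before the level-`2T` tie-chain family of
file LXVIII takes over at `k = T/2 + 5` (gen-21 kernel-A rows `p = 9, 10`; binary16 `n ≤ 1043`):

  `T·E_n ≤ (d+1)·X⁻_n` for every HIGH word with `d ≤ 2^m + 3` whose first five post-prefix
  arguments stay below `2T`                                   (`windowZ`, file LXIX-b).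

With the multiplier `k = d+1 > T/2` the spine's base inequality is short by up to `2T`; the
deficit is recovered from the STRUCTURE OF PHASE 0 (the steps with arguments in `[T, 2T)`, where
RNE errs by `≤ 1` and only at ODD arguments, i.e. at ties, resolved to multiples of `4`):
the potential invariant `4Ψ_i ≤ s'·Cap_i` (`s' = 2k - T ∈ (0, 8]`) of `phase0_step` below, whose
capacity `Cap` charges every error-producing up-tie at least `4` units of the climb of `ŝ` through
`(T, 2T]` (or `2` units plus a pending half-phase), while exact steps are paid for by the `-2T`
per step of `Ψ`.  At the top level `U = 2T·h`, `h ≥ 2`, no potential is needed: five level-0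
arguments (error `≤ 1` instead of `≤ h`) already pay the deficit (`window2_budget`).

* This file (pure arithmetic over `ℤ`, plus one-binade facts): `window_base_neg`,
  `window1_base_pos` (top level `2T`, fed by the phase-0 bound), `window2_budget`,
  `window2_base_pos` (top level `≥ 4T`), `level0_step` (one RNE step with argument below `2T`:
  error `≤ 1`; an inexact step has an odd argument `≥ T` and a result `≡ 0 (mod 4)`; results are
  even or below `T`), `rneZ_even_or_lt`, `phase0_step` (the potential step), `phase0_extract`.
* File LXIX-b: `phase0_bound` (the invariant integrated along phase 0).  File LXIX-c:
  `windowZ`, `windowZ_abs`.  File LXIX-d: the `relErr` wrapper and the rows (E2M1² products,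
  every `p ≥ 10`; binary16 `n ≤ 1043`; binary32 `k ≤ 2^23 + 4`).

References: [Higham2002, §4.2], [IEEE7542019, §4.3.1] (ties-to-even is load-bearing: an up-tie
lands on a multiple of `4`), [LangeRump2019], [BoldoEtAl2023, Thm 4.5].
-/

namespace Summit.Ventures.CertifiedArithmetic.LowPrec.Gemm

open Literature.ComputerArithmetic.FloatingPoint
open Literature.ComputerArithmetic.FloatingPoint.MiniFloat
open Finset

/-! ### Base cases with the multiplier `k = d + 1` (`t` = number of phase-0 steps) -/

/-- BASE on the negative side: `E_b ≤ h·t + 2h`, `X⁻_b ≥ U = 2T·h`. [cell] -/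
theorem window_base_neg {T Hh U k t Eb Xb : ℤ} (hU : U = 2 * T * Hh) (hT : 0 ≤ T) (hHh : 1 ≤ Hh)
    (ht : 0 ≤ t) (htk : t + 1 ≤ k) (hEb : Eb ≤ Hh * t + 2 * Hh) (hXb : U ≤ Xb) :
    T * Eb + (k - 1 - t) * U ≤ k * Xb := by
  subst hU
  have h1 := mul_le_mul_of_nonneg_left hEb hT
  have h2 := mul_le_mul_of_nonneg_left hXb (by linarith : (0 : ℤ) ≤ k)
  have h3 : 0 ≤ T * Hh * t := mul_nonneg (mul_nonneg hT (by linarith)) ht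
  linarith

/-- BASE on the positive side when the top level is `2T` (`h = 1`): the phase-0 bound
`Ψ_I = (T+2k)·E_I - 2T·t - k·(L_I - s_I) ≤ 2T + 2q` (`q ≤ 0`, `q ≤ 2k - T`) and the three cases
of the `2T`-step (not rounded up: `ŝ_b ≥ 2T`; up off a tie: `ŝ_b ≥ 2T + 4`; up at a tie:
`ŝ_b ≥ 2T + 8`) give `T·E_b + (k-1-t)·2T ≤ k·X⁻_b`. [cell] -/
theorem window1_base_pos {T k q t EI sI LI AI zb zab δ Ab Eb Xb : ℤ} (hk0 : 0 ≤ k)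
    (hΨ : (T + 2 * k) * EI - 2 * T * t - k * (LI - sI) ≤ 2 * T + 2 * q)
    (hq0 : q ≤ 0) (hqs : q ≤ 2 * k - T) (hTk : 0 ≤ T + 2 * k) (hEI : EI = AI - sI)
    (hz : zb ≤ zab) (hAb : Ab = AI + zb + δ) (hEb : Eb = EI + δ) (hXb : Xb = LI + zab - Eb)
    (hcase : (δ ≤ 0 ∧ 2 * T ≤ Ab) ∨ (δ ≤ 1 ∧ 2 * T + 4 ≤ Ab) ∨ (δ ≤ 2 ∧ 2 * T + 8 ≤ Ab)) :
    T * Eb + (k - 1 - t) * (2 * T) ≤ k * Xb := by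
  subst hEb hXb hAb hEI
  have hkz := mul_le_mul_of_nonneg_left hz hk0
  rcases hcase with ⟨hδ, hA⟩ | ⟨hδ, hA⟩ | ⟨hδ, hA⟩
  · have e1 := mul_le_mul_of_nonneg_left hδ hTk
    have e2 := mul_le_mul_of_nonneg_left hA hk0
    linarith
  · have e1 := mul_le_mul_of_nonneg_left hδ hTk
    have e2 := mul_le_mul_of_nonneg_left hA hk0
    linarith
  · have e1 := mul_le_mul_of_nonneg_left hδ hTk
    have e2 := mul_le_mul_of_nonneg_left hA hk0
    linarith

/-- THE LEVEL BUDGET when the top level is `U = 2T·h` with `h ≥ 2`: five phase-0 arguments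
below `2T` (error `≤ 1` each instead of `≤ h`) pay for the multiplier `k ≤ T/2 + 4`:
`(T + 2k)·E_I ≤ 2T·h·t` whenever `E_I ≤ h·t - 5(h-1)`, `t + 1 ≤ k`. [cell] -/
theorem window2_budget {T k Hh t EI : ℤ} (hT : 4 ≤ T) (hHh : 2 ≤ Hh)
    (hk8 : 2 * k ≤ T + 8) (ht0 : 0 ≤ t) (htk : t + 1 ≤ k) (hE : EI ≤ Hh * t - 5 * (Hh - 1)) :
    (T + 2 * k) * EI ≤ 2 * T * Hh * t := by
  have hc0 : 0 ≤ T + 2 * k := by linarith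
  have e0 := mul_le_mul_of_nonneg_left hE hc0
  have hTHt : 0 ≤ T * Hh * t := mul_nonneg (mul_nonneg (by linarith) (by linarith)) ht0
  by_cases hB : 0 ≤ Hh * t - 5 * (Hh - 1)
  · have e1 := mul_le_mul_of_nonneg_right (by linarith : T + 2 * k ≤ 2 * T + 8) hB
    have e2 := mul_le_mul_of_nonneg_left (by linarith : 8 * t ≤ 4 * T + 24)
      (by linarith : (0 : ℤ) ≤ Hh)
    have e3 : 0 ≤ (6 * Hh - 12) * T := mul_nonneg (by linarith) (by linarith)
    linarith
  · have e1 : (T + 2 * k) * (Hh * t - 5 * (Hh - 1)) ≤ 0 :=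
      mul_nonpos_of_nonneg_of_nonpos hc0 (by linarith)
    linarith

/-- BASE on the positive side when the top level is `U = 2T·h`, `h ≥ 2`: `E_I ≤ h·t - 5(h-1)`,
`X⁻_b ≥ ŝ_b - 2E_b`, and the three cases of the `U`-step. [cell] -/
theorem window2_base_pos {T Hh U k t EI δ Ab Eb Xb : ℤ} (hU : U = 2 * T * Hh) (hT : 4 ≤ T)
    (hHh : 2 ≤ Hh) (hk8 : 2 * k ≤ T + 8) (ht0 : 0 ≤ t) (htk : t + 1 ≤ k)
    (hEI : EI ≤ Hh * t - 5 * (Hh - 1)) (hEb : Eb = EI + δ) (hXb : Ab - 2 * Eb ≤ Xb)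
    (hcase : (δ ≤ 0 ∧ U ≤ Ab) ∨ (δ ≤ 2 * Hh - 1 ∧ U + 4 * Hh ≤ Ab) ∨
      (δ ≤ 2 * Hh ∧ U + 8 * Hh ≤ Ab)) :
    T * Eb + (k - 1 - t) * U ≤ k * Xb := by
  have hk0 : 0 ≤ k := by linarith
  have hbud := window2_budget hT hHh hk8 ht0 htk hEI
  subst hU hEb
  have e2 := mul_le_mul_of_nonneg_left hXb hk0
  have hTk : 0 ≤ T + 2 * k := by linarith
  have hTH : 0 ≤ T * Hh := mul_nonneg (by linarith) (by linarith)
  have hkH : 0 ≤ k * Hh := mul_nonneg hk0 (by linarith)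
  rcases hcase with ⟨hδ, hA⟩ | ⟨hδ, hA⟩ | ⟨hδ, hA⟩
  · have e1 := mul_le_mul_of_nonneg_left hδ hTk
    have e3 := mul_le_mul_of_nonneg_left hA hk0
    linarith
  · have e1 := mul_le_mul_of_nonneg_left hδ hTk
    have e3 := mul_le_mul_of_nonneg_left hA hk0
    linarith
  · have e1 := mul_le_mul_of_nonneg_left hδ hTk
    have e3 := mul_le_mul_of_nonneg_left hA hk0
    linarith

/-! ### One level-0 step of integer RNE; parity of results -/

/-- ONE LEVEL-0 STEP (argument `V` below `2T = 2^(m+2)`): the error is `≤ 1`; an INEXACT step has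
`T ≤ |V|`, `V` odd (a tie) and a result `≡ 0 (mod 4)` (ties-to-even); the result is even or below
`T`. [cite: IEEE7542019, §4.3.1] -/
theorem level0_step {m : ℕ} {V : ℤ} (hV : V.natAbs < 2 ^ (m + 2)) :
    (rneZ m V - V).natAbs ≤ 1 ∧
    (rneZ m V ≠ V → 2 ^ (m + 1) ≤ V.natAbs ∧ (4 : ℤ) ∣ rneZ m V ∧ ¬ (2 : ℤ) ∣ V) ∧
    ((2 : ℤ) ∣ rneZ m V ∨ (rneZ m V).natAbs < 2 ^ (m + 1)) := by
  by_cases hlt : V.natAbs < 2 ^ (m + 1)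
  · rw [ThetaLawE2M1.rneZ_of_natAbs_lt hlt]
    exact ⟨by simp, fun h => absurd rfl h, Or.inr hlt⟩
  · obtain ⟨-, h2, h3, h4, -, -⟩ :=
      rneZ_level (m := m) (e := 0) (by simpa using not_lt.mp hlt) (by simpa using hV)
    have h2' : (2 : ℤ) ∣ rneZ m V := by simpa using h2
    have h3' : (rneZ m V - V).natAbs ≤ 1 := by simpa using h3
    refine ⟨h3', fun hne => ⟨not_lt.mp hlt, ?_, by omega⟩, Or.inl h2'⟩
    have h5 : (rneZ m V - V).natAbs = 2 ^ 0 := by rw [pow_zero]; omega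
    simpa using h4 h5

/-- Every RNE result is even or below `T` (by levels). [cite: IEEE7542019, §4.3.1] -/
theorem rneZ_even_or_lt {m : ℕ} : ∀ (e : ℕ) {K : ℤ}, K.natAbs < 2 ^ (m + e + 2) →
    (2 : ℤ) ∣ rneZ m K ∨ (rneZ m K).natAbs < 2 ^ (m + 1)
  | 0, K, h => by
      by_cases hlt : K.natAbs < 2 ^ (m + 1)
      · right; rwa [ThetaLawE2M1.rneZ_of_natAbs_lt hlt]
      · left
        have h' : K.natAbs < 2 ^ (m + 0 + 2) := by simpa using h
        simpa using (rneZ_level (e := 0) (by simpa using not_lt.mp hlt) h').2.1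
  | e + 1, K, h => by
      by_cases hlt : K.natAbs < 2 ^ (m + e + 2)
      · exact rneZ_even_or_lt e hlt
      · left
        have h2 := (rneZ_level (e := e + 1) (not_lt.mp hlt) h).2.1
        exact dvd_trans (Dvd.intro (2 ^ (e + 1)) (by ring)) h2

/-- `rneZ_even_or_lt` with the level found from `|K| < 2^|K|`. [cite: IEEE7542019, §4.3.1] -/
theorem rneZ_even_or_lt' {m : ℕ} (K : ℤ) :
    (2 : ℤ) ∣ rneZ m K ∨ (rneZ m K).natAbs < 2 ^ (m + 1) :=
  rneZ_even_or_lt K.natAbs (lt_of_lt_of_le K.natAbs.lt_two_pow_self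
    (Nat.pow_le_pow_right (by norm_num) (by omega)))

/-! ### The phase-0 potential: one step, and the extraction at the end of phase 0 -/

/-- The signed excess `c(x) = x - clamp(x, -T, T)` beyond `±T` is monotone and 1-Lipschitz.
[folklore] -/
theorem exc_mono {T a b ca cb : ℤ} (hca : ca = a - max (-T) (min T a))
    (hcb : cb = b - max (-T) (min T b)) (hT : 0 ≤ T) (hab : a ≤ b) :
    ca ≤ cb ∧ cb - ca ≤ b - a := by omega

/-- The three closed forms of the signed excess `c(x)`. [folklore] -/
theorem exc_cases {T a ca : ℤ} (hca : ca = a - max (-T) (min T a)) (hT : 0 ≤ T) :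
    (T ≤ a → ca = a - T) ∧ (a ≤ T → -T ≤ a → ca = 0) ∧ (a ≤ -T → ca = a + T) := by omega

/-- `|x| ≤ 1` in three cases. [folklore] -/
theorem natAbs_le_one_cases {x : ℤ} (h : x.natAbs ≤ 1) : x = 0 ∨ x = 1 ∨ x = -1 := by omega

/-- THE CLIMB OF AN UP-TIE with a positive letter: the argument `a + z` is odd, `≥ T` in modulus,
and the result `a' = a + z + 1` is a multiple of `4`; from an even-or-small `a` the signed excess
climbs by `≥ 4`, or by `≥ 2` from a pending position (`a ≡ 2 (mod 4)`, `|a| ≥ T + 2`, flag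
`p(a) = 1`). [cell] -/
theorem uptie_climb {T a z a' ca ca' pa : ℤ} (hT : 8 ≤ T) (hT4 : 4 ∣ T) (hz : 0 < z)
    (ha' : a' = a + z + 1) (hV : T ≤ (a + z).natAbs) (h4 : 4 ∣ a') (hodd : ¬ 2 ∣ (a + z))
    (h3 : 2 ∣ a ∨ a.natAbs < T)
    (hcaT : T ≤ a → ca = a - T) (hcam : a ≤ T → -T ≤ a → ca = 0) (hcan : a ≤ -T → ca = a + T)
    (hca'T : T ≤ a' → ca' = a' - T) (hca'n : a' ≤ -T → ca' = a' + T)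
    (hpa0 : 0 ≤ pa) (hpa : a % 4 = 2 → T + 2 ≤ a.natAbs → pa = 1) :
    4 ≤ ca' - ca + 2 * pa := by
  rcases lt_or_gt_of_ne (show a + z ≠ 0 by omega) with hneg | hpos
  · -- negative side: `a + z ≤ -T - 1`, `a ≤ -T - 2` is even
    have hV' : a + z ≤ -T - 1 := by omega
    have ha2 : 2 ∣ a := by
      rcases h3 with h | h
      · exact h
      · omega
    have hca1 : ca = a + T := hcan (by omega)
    have hca2 : ca' = a' + T := hca'n (by omega)
    rcases (show a % 4 = 0 ∨ a % 4 = 2 by omega) with h0 | h0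
    · omega
    · have := hpa h0 (by omega)
      omega
  · -- positive side: `a + z ≥ T + 3`, `a' ≥ T + 4`
    have hV' : T + 3 ≤ a + z := by omega
    have hca2 : ca' = a' - T := hca'T (by omega)
    by_cases haT : a ≤ T
    · have : ca ≤ 0 := by
        by_cases haT' : -T ≤ a
        · rw [hcam haT haT']
        · rw [hcan (by omega)]; omega
      omega
    · have ha2 : 2 ∣ a := by
        rcases h3 with h | h
        · exact h
        · omega
      have hca1 : ca = a - T := hcaT (by omega)
      rcases (show a % 4 = 0 ∨ a % 4 = 2 by omega) with h0 | h0
      · omega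
      · have := hpa h0 (by omega)
        omega

/-- THE PHASE-0 POTENTIAL STEP (pure arithmetic).  One step `a ↦ a' = RNE(a + z)` with argument
below `2T` (facts `h1, h2` of `level0_step`) from an even-or-small `a`; `c(x) = x - clamp(x,-T,T)`
is the signed excess beyond `±T`, `p(x) ∈ {0,1}` flags a pending half phase (`x ≡ 2 (mod 4)`,
`|x| ≥ T + 2`), `zn = z⁻`.  With `s' = 2k - T ∈ (0, 8]`:
`ΔΨ4 = 4(T+2k)·δ - 8T - 4k·z⁻ ≤ s'·ΔCap`, `ΔCap = c(a') - c(a) + 4z⁻ - 2p(a') + 2p(a)`: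
an exact step costs `Cap` at most `2` against `-8T`; an up-tie with `z > 0` gains `4s'` and climbs
`≥ 4` (`uptie_climb`); an up-tie with `z < 0` and every down-tie have `ΔΨ4 ≤ 0 ≤ ΔCap`. [cell] -/
theorem phase0_step {T k a z a' ca ca' pa pa' zn : ℤ} (hT : 8 ≤ T) (hT4 : 4 ∣ T)
    (hs : T < 2 * k) (hk8 : 2 * k ≤ T + 8)
    (h1 : (a' - (a + z)).natAbs ≤ 1)
    (h2 : a' ≠ a + z → T ≤ (a + z).natAbs ∧ 4 ∣ a' ∧ ¬ 2 ∣ (a + z))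
    (h3 : 2 ∣ a ∨ a.natAbs < T)
    (hca : ca = a - max (-T) (min T a)) (hca' : ca' = a' - max (-T) (min T a'))
    (hpa0 : 0 ≤ pa) (hpa : a % 4 = 2 → T + 2 ≤ a.natAbs → pa = 1)
    (hpa'1 : pa' ≤ 1) (hpa' : 4 ∣ a' → pa' = 0) (hzn : zn = max (-z) 0) :
    4 * (T + 2 * k) * (a' - (a + z)) - 8 * T - 4 * k * zn
      ≤ (2 * k - T) * (ca' - ca + 4 * zn - 2 * pa' + 2 * pa) := by
  have hT0 : 0 ≤ T := by linarith
  have hk0 : 0 ≤ k := by linarith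
  have hzn0 : 0 ≤ zn := by rw [hzn]; exact le_max_right _ _
  have hs0 : 0 ≤ 2 * k - T := by linarith
  have hkz : 0 ≤ k * zn := mul_nonneg hk0 hzn0
  obtain ⟨hcaT, hcam, hcan⟩ := exc_cases hca hT0
  obtain ⟨hca'T, -, hca'n⟩ := exc_cases hca' hT0
  rcases natAbs_le_one_cases h1 with hδ | hδ | hδ
  · -- an exact step: `ΔCap ≥ -2`
    have hΔ : 0 ≤ ca' - ca + 4 * zn - 2 * pa' + 2 * pa + 2 := by
      rcases le_or_gt 0 z with hz | hz
      · have hz0 : zn = 0 := by rw [hzn]; exact max_eq_right (by linarith)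
        have := (exc_mono hca hca' hT0 (by omega)).1
        linarith
      · have hz0 : zn = -z := by rw [hzn]; exact max_eq_left (by linarith)
        have := (exc_mono hca' hca hT0 (by omega)).2
        linarith
    have e1 := mul_nonneg hs0 hΔ
    rw [hδ]; linarith
  · -- rounded up: a tie, `a + z` odd, `4 ∣ a'`
    obtain ⟨hV, h4, hodd⟩ := h2 (by omega)
    have hpz : pa' = 0 := hpa' h4
    have hz : z ≠ 0 := by
      rintro rfl
      rcases h3 with h | h
      · exact hodd (by simpa using h)
      · simp at hV; omega
    rcases lt_or_gt_of_ne hz with hzneg | hzpos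
    · have hz0 : zn = -z := by rw [hzn]; exact max_eq_left (by linarith)
      have hm := (exc_mono hca' hca hT0 (by omega)).2
      have hΔ : 0 ≤ ca' - ca + 4 * zn - 2 * pa' + 2 * pa := by
        rw [hpz, hz0]; linarith
      have e1 := mul_nonneg hs0 hΔ
      have e2 := mul_le_mul_of_nonneg_left (show 1 ≤ zn by omega) hk0
      rw [hδ]; linarith
    · have hz0 : zn = 0 := by rw [hzn]; exact max_eq_right (by linarith)
      have hcl := uptie_climb hT hT4 hzpos (by omega) hV h4 hodd h3 hcaT hcam hcan hca'T hca'n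
        hpa0 hpa
      have hΔ : 4 ≤ ca' - ca + 4 * zn - 2 * pa' + 2 * pa := by rw [hpz, hz0]; linarith
      have e1 := mul_le_mul_of_nonneg_left hΔ hs0
      rw [hz0] at e1
      rw [hδ, hz0]; linarith
  · -- rounded down: a tie, `4 ∣ a'`
    obtain ⟨hV, h4, hodd⟩ := h2 (by omega)
    have hpz : pa' = 0 := hpa' h4
    have hz : z ≠ 0 := by
      rintro rfl
      rcases h3 with h | h
      · exact hodd (by simpa using h)
      · simp at hV; omega
    have hΔ : 0 ≤ ca' - ca + 4 * zn - 2 * pa' + 2 * pa := by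
      rcases lt_or_gt_of_ne hz with hzneg | hzpos
      · have hz0 : zn = -z := by rw [hzn]; exact max_eq_left (by linarith)
        have := (exc_mono hca' hca hT0 (by omega)).2
        rw [hpz, hz0]; linarith
      · have hz0 : zn = 0 := by rw [hzn]; exact max_eq_right (by linarith)
        have := (exc_mono hca hca' hT0 (by omega)).1
        rw [hpz, hz0]; linarith
    have e1 := mul_nonneg hs0 hΔ
    rw [hδ]; linarith

/-- EXTRACTION at the end `I` of phase 0 (`t` steps): from the invariant `4Ψ'_I ≤ s'·Cap_I`, the
caps `c(ŝ_I) ≤ T`, `-c(P₀) + 2p(P₀) ≤ 2·(-T-P₀)⁺ ≤ 2(L₀ - s₀)` and `s' ≤ k`: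
`4Ψ_I ≤ s'·T` with `Ψ_I = (T+2k)E_I - 2T·t - k(L_I - s_I)`.  Here `A = L_I - s_I`,
`D0 = L₀ - s₀` (so `2(A - D0) = 4W⁻_I`). [cell] -/
theorem phase0_extract {T k E t A D0 cI cP pI pP mx : ℤ}
    (hinv : 4 * (T + 2 * k) * E - 8 * T * t - 2 * k * A
      ≤ (2 * k - T) * (cI - cP + 2 * (A - D0) - 2 * pI + 2 * pP))
    (hcI : cI ≤ T) (hpI : 0 ≤ pI) (hcP : -cP + 2 * pP ≤ 2 * mx) (hmx0 : 0 ≤ mx)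
    (hmxD : mx ≤ D0) (hAD : D0 ≤ A) (hs0 : 0 ≤ 2 * k - T) (hsk : 2 * k - T ≤ k) (hk0 : 0 ≤ k) :
    4 * ((T + 2 * k) * E - 2 * T * t - k * A) ≤ (2 * k - T) * T := by
  have hCap : cI - cP + 2 * (A - D0) - 2 * pI + 2 * pP ≤ T + 2 * mx + 2 * (A - D0) := by
    linarith
  have e1 := mul_le_mul_of_nonneg_left hCap hs0
  have e2 := mul_le_mul_of_nonneg_right hsk hmx0
  have e3 := mul_le_mul_of_nonneg_left hmxD hk0
  have e4 := mul_le_mul_of_nonneg_right hsk (by linarith : 0 ≤ A - D0)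
  linarith

end Summit.Ventures.CertifiedArithmetic.LowPrec.Gemm
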